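/-
Copyright: statement-level skeleton of a published paper (lit-balaban cell, Phase-2 proof seat p18 gen 8). No proof claims
beyond what the kernel checks below.
-/
import Mathlib
import Literature.MathematicalPhysics.QuantumFieldTheory.Balaban1983to89.B3Eq322Member
import Literature.MathematicalPhysics.QuantumFieldTheory.Balaban1983to89.B3Prop22FreeLinesExample

/-!
# B3 — T. Bałaban, *(Higgs)₂,₃ quantum fields in a finite volume. III. Renormalization*, CMP **88** (1983) 411–445
[Balaban1983Higgs3], p. 438 [PDF 28], the sentence of **(3.19)/(3.20)**: *"Primitively divergent graphs [graphs whose every proper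
subgraph is convergent, p. 435] … We get a generalized expression of degree +α represented by some generalized graph whose every
subgraph has a positive degree also"* — PROVED as a theorem about the family of generalized graphs of Proposition 2.2 (gen 7's
`famK`): if every PROPER connected subgraph along every ordering has positive degree (primitive divergence) and the extra line
dimensions `κ_l ≥ 0` raise the degree of the WHOLE graph above zero (`D(G) + Σ_lκ_l > 0`, e.g. `D(G) = 0` and `Σκ = α > 0`), then
the PRINTED hypothesis of Propositions 2.1/2.2 holds for the generalized graph through positivity, hence (1.33) for it by
`prop21_freeLines`; with the members of (3.22) (`B3Eq322Member.memberK322`) and of (3.12) (`B3FreeLine.memberK24 (3/2)`)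
re-derived as instances

statement-level skeleton of published theorems with citation tags; proofs where landed; nothing here is a claim about
the Yang–Mills mass gap

PDF held: `paper:balaban1983-higgs-2-3-quantum-fields-finite-volume` (journal page = PDF page + 410); pp. 435, 438 [PDF 25, 28] read
in the OCR text (`p0025.txt`, `p0028.txt`).

CITATION HEADER (lean-in-tree rule).  Part of the lit-balaban TYPED SKELETON (HOME `run/shared/lean/pub/lit-balaban/`), PHASE 2,
seat p18 generation 8.  WHAT IS REPRODUCED: rows **B3.Eq3.18-3.20** (the (3.20) sentence; cell: *"the picture (3.20) not typed"*),
**B3.Prop2.2** (how Sect. 3's generalized graphs meet its hypothesis) and **B3.Eq3.21-3.24** / **B3.Eq3.11-3.17** (instances) of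
`HOME/lit-balaban-r15/ROWS-B3.md` (fold owner r15, referee ref-4).  CONSUMES BY NAME, nothing re-proved: p19's `Counts`/`Model`
calculus (`reps`, `before`, `Nontriv`, `relabelCounts`, `Component`, `degQ`), gen 7's `B3FreeLine` (`CGraphK`, `DatumK`,
`expansionK`, `famK`, `degQK`, `Is24K`, `prop21_freeLines`), gen 7's worked member `memberK24 (3/2)` of (3.12)
(`B3Prop22FreeLinesExample`: `degQ_graph24`, `before_one_graph24`, `block_graph24`, `relabelCounts_graph24`) and gen 8's `memberK322`
of (3.22) (`B3Eq322Member`: `degQ_one`, `degQ_two`, `before_one`, `before_two`, `block_graph322`).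

THE PRINTED TEXT (verbatim).  p. 435: *"The method described below, and even a simplified one, will be applied to all other
primitively divergent graphs (graphs whose every proper subgraph is convergent)."*  p. 438: *"Primitively divergent graphs, i.e. the
graphs (3.18) are treated in a simpler way. If Σ(x,x′) is an expression corresponding to any such graph, then we have a graph with mass
renormalization counterterm of the form −Σ_{x′}η^dΣ(x,x′), and we write [(3.19)]. We get a generalized expression of degree +α
represented by some generalized graph whose every subgraph has a positive degree also. Graphically we write it as follows [(3.20)]."*
p. 445: *"A graph of this set has the property that each of its subgraphs appearing within some ordering has positive degree. Thus
the only divergent graphs can be the whole graphs of the set."*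

WHAT IS PROVED, and how (the combinatorial half of the sentence; its analytic half — the gain `(L^jη)^α` of (3.19) — is p20 g3's
`B3SubtractionAlphaGain`).  In the language of the family: a connected subgraph *"appearing within some ordering"* is a non-trivial
block `(σ, i, b)` of p19's `Component` (the component of `G_i` along the ordering `σ` represented by `b`); it is the WHOLE graph iff
its line set `before i b` is all of the lines (`univ`), a PROPER subgraph otherwise.  §1: `degQK_eq_of_before_eq_univ` (on a whole
block the generalized degree is `D + Σ_lκ_l`, for every ordering — `Equiv.sum_comp`), `degQ_le_degQK` (`κ ≥ 0` never lowers a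
degree).  §2: **`posSubgraphsExcept24_of_properPos`** — for a member `G` of `famK` with `κ ≥ 0`, proper blocks of positive degree and
`0 < D + Σκ` on whole blocks, r15's PRINTED hypothesis `PosSubgraphsExcept24 (expansionK P mb D) G` holds (through positivity:
`posSubgraphs_of_properPos`), and **`ineq133_of_properPos`**: (1.33) for it by `prop21_freeLines`; the printed special case
**`posSubgraphsExcept24_of_degZero`** (*"degree +α"*: whole-graph degree `0` — p. 438 *"All the remaining divergent graphs of this type
have degrees equal to 0"* — and `Σκ > 0`).  §3 instances: the (3.22) member `memberK322` (proper blocks `D = 1, 2 > 0`, whole `D = 0`,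
`Σκ = ½`: `properPos_graph322`, `wholePos_graph322`, `posSubgraphsExcept24_memberK322'`) and the (3.12) member `memberK24 (3/2)` (one
line: no proper non-trivial block; whole `D = 0`, `κ = 3/2`: `posSubgraphsExcept24_memberK24_shift'`).
§4 (v1.1): p. 438 *"The same procedure is applied to all divergent self-energy graphs G₀ if no divergent subgraphs appear within the given
ordering, with the possible exception of the graphs (2.4). When this graph appears, then we apply the integration by parts formula (2.8)
again"* — **`posSubgraphsExcept24_of_properPosExcept24`**: the same conclusion when every proper non-trivial block is EITHER of positive
degree OR a (2.4)-block of the generalized graph (gen 7's `Is24K`: the exception clause of r15's hypothesis, handled inside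
`prop21_freeLines` by the integration by parts (2.8)), and **`ineq133_of_properPosExcept24`**.
HONEST SCOPE: a statement about the abstract-amplitude family `famK` (as `B3Eq322Member`); "subgraph" = non-trivial block along an
ordering (the tree's reading of r15's `Sub`, p19); the characteristic function `γ(G′,l̃′)` of (3.5) is `≡ 1` in this situation (all
orderings: the family's `Sub` ranges over every ordering, so the per-ordering refinement *"within the given ordering"* is rendered by its
all-orderings form); nothing is said about graphs that are not primitively divergent beyond §4 (the induction of pp. 444–445).  D-0026:
theorems only (no new definitions, no named facts, no `sorry`); standard axioms.  Unit `lit-balaban-p18-g8`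
(literature-prover-lit-balaban-p18-g8-0), HOME `run/shared/lean/pub/lit-balaban/`, 2026-08-21 (v1.1: §4 appended, nothing else changed).
-/

open Finset

namespace Literature.MathematicalPhysics.QuantumFieldTheory.Balaban1983to89.B3Eq320PositiveSubgraphs

open B3Ineq215 B3Ineq213 B3Sect2FirstEstimate B3Prop1 B3FreeLine B3Eq322Member

variable {V : Type} [Fintype V] [DecidableEq V] {m : ℕ}

/-! ## §1 Whole blocks and proper blocks -/

/-- On a block containing ALL the lines (the whole graph, reached along the ordering `σ`) the generalized degree is `D + Σ_lκ_l` —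
the sum of the extra dimensions does not depend on the ordering. [cite: Balaban1983Higgs3, (3.20) p.438] -/
theorem degQK_eq_of_before_eq_univ (G : Counts V m) (κ : Fin m → ℚ) (σ : Equiv.Perm (Fin m)) {i : ℕ} {b : V}
    (h : (relabelCounts G σ).toModel.before i b = univ) :
    degQK (relabelCounts G σ) (κ ∘ σ) i b = degQ (relabelCounts G σ) i b + ∑ l, κ l := by
  unfold degQK
  rw [h]
  congr 1
  exact Equiv.sum_comp σ κ

/-- Non-negative extra dimensions never lower the degree of a block: `D ≤ D_K`. [cite: Balaban1983Higgs3, (3.20) p.438] -/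
theorem degQ_le_degQK (G : Counts V m) (κ : Fin m → ℚ) (hκ : ∀ l, 0 ≤ κ l) (i : ℕ) (b : V) :
    degQ G i b ≤ degQK G κ i b := by
  unfold degQK
  exact le_add_of_nonneg_right (sum_nonneg fun l _ => hκ l)

/-! ## §2 The (3.20) sentence: primitively divergent + degree raised above zero ⇒ every subgraph positive -/

/-- **p. 438, (3.19)/(3.20): "We get a generalized expression … represented by some generalized graph whose every subgraph has a
positive degree also"** — the exception-free form: for a generalized graph of the family with extra line dimensions `κ ≥ 0` (`hκ`),
every PROPER connected subgraph along every ordering of positive degree (`hprop`: *"primitively divergent graphs (graphs whose every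
proper subgraph is convergent)"*, p. 435) and the degree of the WHOLE graph raised above zero (`hwhole`: `0 < D + Σ_lκ_l`), EVERY
connected subgraph along every ordering has positive generalized degree. [cite: Balaban1983Higgs3, (3.20) p.438] -/
theorem posSubgraphs_of_properPos {P : ParamsK} {mb : ℕ} (D : DatumK P) (G : CGraphK P mb) (hκ : ∀ l, 0 ≤ G.κ l)
    (hprop : ∀ (σ : Equiv.Perm (Fin G.m)) (i : ℕ) (b : Fin G.n), b ∈ (relabelCounts G.G σ).toModel.reps i →
      (relabelCounts G.G σ).toModel.Nontriv i b → (relabelCounts G.G σ).toModel.before i b ≠ univ →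
      0 < degQ (relabelCounts G.G σ) i b)
    (hwhole : ∀ (σ : Equiv.Perm (Fin G.m)) (i : ℕ) (b : Fin G.n), (relabelCounts G.G σ).toModel.before i b = univ →
      0 < degQ (relabelCounts G.G σ) i b + ∑ l, G.κ l) :
    ∀ H : (expansionK P mb D).Sub G, 0 < (expansionK P mb D).subDeg G H := by
  show ∀ H : Component G.G, 0 < degQK (relabelCounts G.G H.1) (G.κ ∘ H.1) H.2.1 H.2.2.1
  rintro ⟨σ, i, b, hb, hn⟩
  change 0 < degQK (relabelCounts G.G σ) (G.κ ∘ σ) i b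
  by_cases h : (relabelCounts G.G σ).toModel.before i b = univ
  · rw [degQK_eq_of_before_eq_univ G.G G.κ σ h]
    exact hwhole σ i b h
  · exact (hprop σ i b hb hn h).trans_le (degQ_le_degQK _ _ (fun l => hκ (σ l)) i b)

/-- **The PRINTED hypothesis of Propositions 2.1/2.2 for such a generalized graph** — r15's `PosSubgraphsExcept24` on the expansion of
the family, met through positivity (no exceptional subgraph (2.4) needed). [cite: Balaban1983Higgs3, Prop. 2.2 p.428] -/
theorem posSubgraphsExcept24_of_properPos {P : ParamsK} {mb : ℕ} (D : DatumK P) (G : CGraphK P mb) (hκ : ∀ l, 0 ≤ G.κ l)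
    (hprop : ∀ (σ : Equiv.Perm (Fin G.m)) (i : ℕ) (b : Fin G.n), b ∈ (relabelCounts G.G σ).toModel.reps i →
      (relabelCounts G.G σ).toModel.Nontriv i b → (relabelCounts G.G σ).toModel.before i b ≠ univ →
      0 < degQ (relabelCounts G.G σ) i b)
    (hwhole : ∀ (σ : Equiv.Perm (Fin G.m)) (i : ℕ) (b : Fin G.n), (relabelCounts G.G σ).toModel.before i b = univ →
      0 < degQ (relabelCounts G.G σ) i b + ∑ l, G.κ l) :
    PosSubgraphsExcept24 (expansionK P mb D) G :=
  ⟨trivial, fun H => Or.inr (posSubgraphs_of_properPos D G hκ hprop hwhole H)⟩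

/-- **"a generalized expression of degree +α"** (p. 438): the printed special case — the whole graph has degree `0` along every
ordering (*"All the remaining divergent graphs of this type have degrees equal to 0"*) and the extra dimensions are non-negative
with a positive sum `α`; every proper subgraph being convergent, the printed hypothesis holds. [cite: Balaban1983Higgs3, (3.20) p.438] -/
theorem posSubgraphsExcept24_of_degZero {P : ParamsK} {mb : ℕ} (D : DatumK P) (G : CGraphK P mb) (hκ : ∀ l, 0 ≤ G.κ l)
    (hα : 0 < ∑ l, G.κ l)
    (hprop : ∀ (σ : Equiv.Perm (Fin G.m)) (i : ℕ) (b : Fin G.n), b ∈ (relabelCounts G.G σ).toModel.reps i →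
      (relabelCounts G.G σ).toModel.Nontriv i b → (relabelCounts G.G σ).toModel.before i b ≠ univ →
      0 < degQ (relabelCounts G.G σ) i b)
    (hzero : ∀ (σ : Equiv.Perm (Fin G.m)) (i : ℕ) (b : Fin G.n), (relabelCounts G.G σ).toModel.before i b = univ →
      degQ (relabelCounts G.G σ) i b = 0) :
    PosSubgraphsExcept24 (expansionK P mb D) G :=
  posSubgraphsExcept24_of_properPos D G hκ hprop fun σ i b h => by rw [hzero σ i b h, zero_add]; exact hα

/-- **(1.33) for every such generalized graph**, as asserted by Proposition 2.2 for the family (`prop21_freeLines`, the constant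
`O(1)(n̄)` of the family at the size bound): the analytic use of *"whose every subgraph has a positive degree"*.
[cite: Balaban1983Higgs3, Prop. 2.2 p.428] -/
theorem ineq133_of_properPos (P : ParamsK) (mbar : ℕ → ℕ) (nbar : ℕ) (α₀ : ℝ) (h0 : 0 < α₀) (h1 : α₀ < 1) :
    ∃ δ₀ C : ℝ, 0 < δ₀ ∧ 0 < C ∧ ∀ (D : DatumK P) (G : CGraphK P (mbar nbar)), (∀ l, 0 ≤ G.κ l) →
      (∀ (σ : Equiv.Perm (Fin G.m)) (i : ℕ) (b : Fin G.n), b ∈ (relabelCounts G.G σ).toModel.reps i →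
        (relabelCounts G.G σ).toModel.Nontriv i b → (relabelCounts G.G σ).toModel.before i b ≠ univ →
        0 < degQ (relabelCounts G.G σ) i b) →
      (∀ (σ : Equiv.Perm (Fin G.m)) (i : ℕ) (b : Fin G.n), (relabelCounts G.G σ).toModel.before i b = univ →
        0 < degQ (relabelCounts G.G σ) i b + ∑ l, G.κ l) →
      Ineq133At (famK P mbar nbar D).toExpansion ((famK P mbar nbar D).single G) α₀ δ₀ C := by
  obtain ⟨δ₀, hδ₀, H⟩ := prop21_freeLines P mbar
  obtain ⟨C, hC, HC⟩ := H α₀ h0 h1 nbar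
  exact ⟨δ₀, C, hδ₀, hC, fun D G hκ hprop hwhole => HC D G (posSubgraphsExcept24_of_properPos D G hκ hprop hwhole)⟩

/-! ## §3 Instances: the generalized graphs of (3.22) and of (3.12) -/

/-- The second graph of (3.21) is primitively divergent: its proper connected subgraphs along any ordering — the blocks `G′₁` made
of one line — have degrees `1` (scalar line) or `2` (vector line), both positive. [cite: Balaban1983Higgs3, (3.21) p.438] -/
theorem properPos_graph322 (σ : Equiv.Perm (Fin 2)) (i : ℕ) (b : Fin 2) (hb : b ∈ (relabelCounts graph322 σ).toModel.reps i)
    (hn : (relabelCounts graph322 σ).toModel.Nontriv i b) (hne : (relabelCounts graph322 σ).toModel.before i b ≠ univ) :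
    0 < degQ (relabelCounts graph322 σ) i b := by
  -- a non-trivial block has `i ≥ 1`; `i ≥ 2` blocks contain both lines, so a proper block has `i = 1`, `b = 0`
  have hi1 : 1 ≤ i := by
    by_contra h0
    have h0' : i = 0 := by omega
    rw [h0'] at hn
    exact absurd hn (by simp [Model.Nontriv, Model.before_zero])
  by_cases hi : i = 1
  · subst hi
    have hb0 : b = 0 := by
      have := (relabelCounts graph322 σ).toModel.mem_reps.1 hb
      rw [rep_one] at this
      exact this.symm
    subst hb0
    rw [degQ_one]
    split_ifs <;> norm_num
  · -- `i ≥ 2`: the block of `b` contains every line (both have `src = 0` and `rep i 0 = b`… ), contradiction with `hne`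
    exfalso
    apply hne
    have hi2 : 2 ≤ i := by omega
    -- every line `l` has `(l : ℕ) < 2 ≤ i` and `rep i (src l) = rep i 0`; and `b = rep i b` with `b` reached from a line
    obtain ⟨l₀, hl₀⟩ := hn
    rw [Model.mem_before] at hl₀
    ext l
    simp only [Model.mem_before, mem_univ, iff_true]
    refine ⟨lt_of_lt_of_le l.isLt hi2, ?_⟩
    -- both lines start at the vertex `0`
    have hsrc : ∀ l' : Fin 2, (relabelCounts graph322 σ).toModel.src l' = 0 := fun _ => rfl
    have := hl₀.2
    rw [hsrc] at this ⊢
    exact this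

/-- … and its whole graph has degree `0` with `Σκ = ½ > 0`: along any ordering a block containing both lines has `D = 0`.
[cite: Balaban1983Higgs3, (3.21) p.438] -/
theorem wholePos_graph322 (σ : Equiv.Perm (Fin 2)) (i : ℕ) (b : Fin 2)
    (h : (relabelCounts graph322 σ).toModel.before i b = univ) :
    0 < degQ (relabelCounts graph322 σ) i b + ∑ l, κ322 l := by
  -- a block with both lines: `i ≥ 2`, and then the quotient is the one of `G′₂` (all vertices merged into `0`)
  have hmem : (1 : Fin 2) ∈ (relabelCounts graph322 σ).toModel.before i b := by rw [h]; exact mem_univ _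
  rw [Model.mem_before] at hmem
  have hi2 : 2 ≤ i := by have := hmem.1; simp at this; omega
  -- the representative map is constant `0` from level `2` on
  have hrep : ∀ (n : ℕ), 2 ≤ n → ∀ v : Fin 2, (relabelCounts graph322 σ).toModel.rep n v = 0 := by
    intro n hn
    induction n with
    | zero => omega
    | succ n ih =>
      intro v
      by_cases hn2 : n < 2
      · have : n = 1 := by omega
        subst this
        exact rep_two σ v
      · rw [(relabelCounts graph322 σ).toModel.rep_succ_of_not_lt (by simpa using hn2) v]
        exact ih (by omega) v
  have hb0 : b = 0 := by
    have := hmem.2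
    rw [hrep i hi2] at this
    exact this.symm
  subst hb0
  -- degree of the whole block: fiber = univ, before = univ
  have hfiber : (relabelCounts graph322 σ).toModel.fiber i 0 = univ := by
    ext v; simp [Model.mem_fiber, hrep i hi2]
  have hdeg : degQ (relabelCounts graph322 σ) i 0 = 0 := by
    unfold degQ
    rw [hfiber, h]
    have hsum : ∑ l : Fin 2, lineDimQ (relabelCounts graph322 σ) l = -3 := by
      simp only [lineDimQ_relabel]
      rw [Equiv.sum_comp σ (fun i : Fin 2 => if i = 0 then (-2 : ℚ) else -1)]
      simp [Fin.sum_univ_two]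
      norm_num
    rw [hsum]
    simp only [relabelCounts, graph322, Fin.sum_univ_two, Nat.cast_ofNat, Nat.cast_zero, add_zero]
    norm_num
  rw [hdeg, zero_add]
  simp [κ322]

/-- **The (3.22) member meets the printed hypothesis as an instance of the (3.20) mechanism** (second proof of
`B3Eq322Member.posSubgraphsExcept24_memberK322`). [cite: Balaban1983Higgs3, (3.22) p.439] -/
theorem posSubgraphsExcept24_memberK322' (Cmax CD : ℝ) {mb : ℕ} (h : 2 ≤ mb) (D : DatumK (paramsK322 Cmax CD)) :
    PosSubgraphsExcept24 (expansionK (paramsK322 Cmax CD) mb D) (memberK322 Cmax CD h) :=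
  posSubgraphsExcept24_of_properPos D (memberK322 Cmax CD h)
    (fun l => by change 0 ≤ κ322 l; unfold κ322; split_ifs <;> norm_num)
    (fun σ i b hb hn hne => properPos_graph322 σ i b hb hn hne)
    (fun σ i b hw => wholePos_graph322 σ i b hw)

/-- The graph (2.4) (one line) has NO proper non-trivial block: every non-trivial block along the (only) ordering contains the
line. [cite: Balaban1983Higgs3, (2.4) p.424] -/
theorem properPos_graph24 (σ : Equiv.Perm (Fin 1)) (i : ℕ) (b : Fin 2) (hn : (relabelCounts graph24 σ).toModel.Nontriv i b)
    (hne : (relabelCounts graph24 σ).toModel.before i b ≠ univ) : 0 < degQ (relabelCounts graph24 σ) i b := by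
  exfalso
  rw [relabelCounts_graph24] at hn hne
  apply hne
  obtain ⟨l₀, hl₀⟩ := hn
  ext l
  simp only [mem_univ, iff_true]
  rwa [Fin.eq_zero l, ← Fin.eq_zero l₀]

/-- … and its whole graph has degree `0` (`degQ_graph24`), so with the line dimension raised by `1 + α = 3/2` the whole block has
generalized degree `3/2 > 0`, at whatever level `i ≥ 1` it is read. [cite: Balaban1983Higgs3, (3.12) p.436] -/
theorem wholePos_graph24_shift (σ : Equiv.Perm (Fin 1)) (i : ℕ) (b : Fin 2)
    (hw : (relabelCounts graph24 σ).toModel.before i b = univ) :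
    0 < degQ (relabelCounts graph24 σ) i b + ∑ _l : Fin 1, (3 / 2 : ℚ) := by
  rw [relabelCounts_graph24] at hw ⊢
  have hmem : (0 : Fin 1) ∈ graph24.toModel.before i b := by rw [hw]; exact mem_univ _
  rw [Model.mem_before] at hmem
  have hi1 : 1 ≤ i := by have := hmem.1; simp at this; omega
  -- from level `1` on the representative map is constant `0`
  have hrep : ∀ (n : ℕ), 1 ≤ n → ∀ v : Fin 2, graph24.toModel.rep n v = 0 := by
    intro n hn
    induction n with
    | zero => omega
    | succ n ih =>
      intro v
      by_cases hn1 : n < 1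
      · have : n = 0 := by omega
        subst this
        exact rep_one_graph24 v
      · rw [graph24.toModel.rep_succ_of_not_lt (by simpa using hn1) v]
        exact ih (by omega) v
  have hb0 : b = 0 := by
    have := hmem.2
    rw [hrep i hi1] at this
    exact this.symm
  subst hb0
  have hfiber : graph24.toModel.fiber i 0 = univ := by
    ext v; simp [Model.mem_fiber, hrep i hi1]
  have hdeg : degQ graph24 i 0 = 0 := by
    have h1 := degQ_graph24
    unfold degQ at h1 ⊢
    rw [hfiber, hw]
    rw [fiber_one_graph24, before_one_graph24] at h1
    have huniv : (univ : Finset (Fin 1)) = {0} := by ext l; simp [Fin.eq_zero l]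
    rw [huniv]
    exact h1
  rw [hdeg]
  norm_num

/-- **The (3.12) member** (gen 7's `memberK24 (3/2)`: the graph (2.4) with its line dimension raised by `1 + α = 3/2`) **meets the
printed hypothesis as an instance of the same mechanism** (second proof of `B3FreeLine.posSubgraphsExcept24_memberK24_shift`).
[cite: Balaban1983Higgs3, (3.12) p.436] -/
theorem posSubgraphsExcept24_memberK24_shift' (Cmax CD : ℝ) {mb : ℕ} (h : 1 ≤ mb) (D : DatumK (paramsK24 Cmax CD)) :
    PosSubgraphsExcept24 (expansionK (paramsK24 Cmax CD) mb D) (memberK24 Cmax CD h (3 / 2) (shift_mem_menu24 Cmax CD)) :=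
  posSubgraphsExcept24_of_properPos D _ (fun _ => by change (0 : ℚ) ≤ 3 / 2; norm_num)
    (fun σ i b _ hn hne => properPos_graph24 σ i b hn hne)
    (fun σ i b hw => wholePos_graph24_shift σ i b hw)

/-! ## §4 The exception (2.4) inside a proper subgraph -/

/-- **p. 438: "The same procedure is applied to all divergent self-energy graphs G₀ if no divergent subgraphs appear within the given
ordering, with the possible exception of the graphs (2.4). When this graph appears, then we apply the integration by parts formula
(2.8) again."** — for a generalized graph of the family with `κ ≥ 0`, every PROPER non-trivial block along every ordering EITHER a
(2.4)-block of the generalized graph (`Is24K`: degree `0`, one differentiated standard line — the exception clause of the printed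
hypothesis, treated by (2.8) inside Proposition 2.2) OR of positive degree, and `0 < D + Σ_lκ_l` on the blocks containing all lines, the
PRINTED hypothesis of Propositions 2.1/2.2 holds. [cite: Balaban1983Higgs3, (3.20) p.438] -/
theorem posSubgraphsExcept24_of_properPosExcept24 {P : ParamsK} {mb : ℕ} (D : DatumK P) (G : CGraphK P mb) (hκ : ∀ l, 0 ≤ G.κ l)
    (hprop : ∀ (σ : Equiv.Perm (Fin G.m)) (i : ℕ) (b : Fin G.n), b ∈ (relabelCounts G.G σ).toModel.reps i →
      (relabelCounts G.G σ).toModel.Nontriv i b → (relabelCounts G.G σ).toModel.before i b ≠ univ →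
      Is24K (relabelCounts G.G σ) (G.κ ∘ σ) i b ∨ 0 < degQ (relabelCounts G.G σ) i b)
    (hwhole : ∀ (σ : Equiv.Perm (Fin G.m)) (i : ℕ) (b : Fin G.n), (relabelCounts G.G σ).toModel.before i b = univ →
      0 < degQ (relabelCounts G.G σ) i b + ∑ l, G.κ l) :
    PosSubgraphsExcept24 (expansionK P mb D) G := by
  refine ⟨trivial, ?_⟩
  show ∀ H : Component G.G,
    Is24K (relabelCounts G.G H.1) (G.κ ∘ H.1) H.2.1 H.2.2.1 ∨ 0 < degQK (relabelCounts G.G H.1) (G.κ ∘ H.1) H.2.1 H.2.2.1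
  rintro ⟨σ, i, b, hb, hn⟩
  change Is24K (relabelCounts G.G σ) (G.κ ∘ σ) i b ∨ 0 < degQK (relabelCounts G.G σ) (G.κ ∘ σ) i b
  by_cases h : (relabelCounts G.G σ).toModel.before i b = univ
  · right
    rw [degQK_eq_of_before_eq_univ G.G G.κ σ h]
    exact hwhole σ i b h
  · rcases hprop σ i b hb hn h with h24 | hpos
    · exact Or.inl h24
    · exact Or.inr (hpos.trans_le (degQ_le_degQK _ _ (fun l => hκ (σ l)) i b))

/-- The positivity form of §2 is the special case without exceptional blocks. [cite: Balaban1983Higgs3, (3.20) p.438] -/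
theorem posSubgraphsExcept24_of_properPos' {P : ParamsK} {mb : ℕ} (D : DatumK P) (G : CGraphK P mb) (hκ : ∀ l, 0 ≤ G.κ l)
    (hprop : ∀ (σ : Equiv.Perm (Fin G.m)) (i : ℕ) (b : Fin G.n), b ∈ (relabelCounts G.G σ).toModel.reps i →
      (relabelCounts G.G σ).toModel.Nontriv i b → (relabelCounts G.G σ).toModel.before i b ≠ univ →
      0 < degQ (relabelCounts G.G σ) i b)
    (hwhole : ∀ (σ : Equiv.Perm (Fin G.m)) (i : ℕ) (b : Fin G.n), (relabelCounts G.G σ).toModel.before i b = univ →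
      0 < degQ (relabelCounts G.G σ) i b + ∑ l, G.κ l) :
    PosSubgraphsExcept24 (expansionK P mb D) G :=
  posSubgraphsExcept24_of_properPosExcept24 D G hκ (fun σ i b hb hn hne => Or.inr (hprop σ i b hb hn hne)) hwhole

/-- **(1.33) for every such generalized graph** (Proposition 2.2 for the family, `prop21_freeLines`: the (2.4)-blocks are integrated by
parts, the other subgraphs have positive degrees). [cite: Balaban1983Higgs3, Prop. 2.2 p.428] -/
theorem ineq133_of_properPosExcept24 (P : ParamsK) (mbar : ℕ → ℕ) (nbar : ℕ) (α₀ : ℝ) (h0 : 0 < α₀) (h1 : α₀ < 1) :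
    ∃ δ₀ C : ℝ, 0 < δ₀ ∧ 0 < C ∧ ∀ (D : DatumK P) (G : CGraphK P (mbar nbar)), (∀ l, 0 ≤ G.κ l) →
      (∀ (σ : Equiv.Perm (Fin G.m)) (i : ℕ) (b : Fin G.n), b ∈ (relabelCounts G.G σ).toModel.reps i →
        (relabelCounts G.G σ).toModel.Nontriv i b → (relabelCounts G.G σ).toModel.before i b ≠ univ →
        Is24K (relabelCounts G.G σ) (G.κ ∘ σ) i b ∨ 0 < degQ (relabelCounts G.G σ) i b) →
      (∀ (σ : Equiv.Perm (Fin G.m)) (i : ℕ) (b : Fin G.n), (relabelCounts G.G σ).toModel.before i b = univ →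
        0 < degQ (relabelCounts G.G σ) i b + ∑ l, G.κ l) →
      Ineq133At (famK P mbar nbar D).toExpansion ((famK P mbar nbar D).single G) α₀ δ₀ C := by
  obtain ⟨δ₀, hδ₀, H⟩ := prop21_freeLines P mbar
  obtain ⟨C, hC, HC⟩ := H α₀ h0 h1 nbar
  exact ⟨δ₀, C, hδ₀, hC, fun D G hκ hprop hwhole =>
    HC D G (posSubgraphsExcept24_of_properPosExcept24 D G hκ hprop hwhole)⟩

end Literature.MathematicalPhysics.QuantumFieldTheory.Balaban1983to89.B3Eq320PositiveSubgraphs
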